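import Mathlib.Probability.Distributions.Gaussian.Multivariate
import Mathlib.MeasureTheory.Measure.WithDensity
import Mathlib.Analysis.SpecialFunctions.Log.Basic
import Literature.Probability.LatticeModels.Correlations
import Literature.Probability.LatticeModels.LatticeGraph
import HarnessLib

/-!
# The Polchinski renormalisation flow (Bauerschmidt–Bodineau–Dagallier) and the Kadanoff
# block-spin semigroup

Topic `Literature/Probability/LatticeModels`; definition request `defn-PolchinskiIsingFlow` (route
CriticalPhenomena/Ising3DConformalLimit `MonotoneRG`, crux `StrongOrderPolchinski` =
stmt-CriticalPhenomena-6919, which needs a typed renormalisation semiflow on laws of fields).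

Two real definitions are provided, at the two levels the request names.

1. **The Polchinski flow in finite dimension, verbatim after Bauerschmidt–Bodineau–Dagallier
   (Probab. Surveys 2024, arXiv:2307.07619), §3.1–3.2, Definition 2** (`namespace Polchinski`).
   Data: a finite index set `ι` (the sites of a finite volume, e.g. a discrete torus), a
   COVARIANCE DECOMPOSITION `D` (`CovDecomposition ι`: increasing positive semidefinite matrices
   `C_t`, `t ≥ 0`, `C_0 = 0`, below a terminal covariance `C_∞`), and an initial potential
   `V₀ : ℝ^ι → ℝ` (the measure `ν₀ ∝ e^{-V₀} d𝖯_{C_∞}`, eq. (3.7)). Gaussian expectations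
   `𝖤_C` are integrals against Mathlib's `ProbabilityTheory.multivariateGaussian 0 C` on
   `EuclideanSpace ℝ ι`. Then (Def. 2, eqs. (3.8)–(3.10)):
   * `renormPotential D V₀ t φ = V_t(φ) = -log 𝖤_{C_t}[e^{-V₀(φ+ζ)}]`;
   * `semigroup D V₀ s t F φ = 𝖯_{s,t}F(φ) = e^{V_t(φ)} 𝖤_{C_t-C_s}[e^{-V_s(φ+ζ)} F(φ+ζ)]`;
   * `renormMeasure D V₀ t = ν_t`, `𝔼_{ν_t}[F] = e^{V_∞(0)} 𝖤_{C_∞-C_t}[e^{-V_t(ζ)} F(ζ)]` — here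
     as the NORMALISED measure `(Z_t)⁻¹ · e^{-V_t} d𝖯_{C_∞-C_t}` (so `e^{V_∞(0)} = Z_t⁻¹` is not
     asserted but built in; `ν_0 = ν₀`);
   * `fluctuationMeasure D V₀ t φ = μ_t^φ` (eq. (3.12)).
   PROVED API: `renormPotential_zero` (`V` at `t = 0` is `V₀`, since `𝖯_0 = δ_0`),
   `semigroup_self` (`𝖯_{t,t} = id`), `multivariateGaussian_zero_zero` (`𝖯_0 = δ_0`).
   The Polchinski equation `∂_t V_t = ½Δ_{Ċ_t}V_t - ½(∇V_t)²_{Ċ_t}` (Prop. 7), the duality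
   `𝔼_{ν_t}[𝖯_{s,t}F] = 𝔼_{ν_s}[F]` (Prop. 6/8) and the ISING instance (Hubbard–Stratonovich
   embedding of `±1` spins with coupling matrix `βJ + λ` into `ν₀ ∝ e^{-V₀} d𝖯_{C_∞}`,
   Bauerschmidt–Dagallier arXiv:2202.02301 §1.2; BBD §6) are NOT formalised here: the former two
   are theorems about these definitions, the latter is a further definition (the choice
   `C_∞ = (βJ + λ)^{-1}`-type decomposition and the single-site potential) left to a follow-up.
2. **The Kadanoff block-spin maps on laws of fields over `ℤ^d`** (`namespace Kadanoff`; the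
   "lattice alternative … acceptable variant if recorded as such" of the request):
   `blockSpin b c φ x = c · ∑_{y ∈ [0,b)^d} φ(b x + y)` (`c = b^{-d}`: block AVERAGE; general `c`
   = field renormalisation `ρ`), `blockSpinLaw b c μ = law of blockSpin under μ` for a measure `μ`
   on fields `Site d → ℝ`, and `spinField` embedding `±1` spin configurations; PROVED:
   measurability and the SEMIGROUP PROPERTY `blockSpin b c ∘ blockSpin b' c' = blockSpin (b b') (c c')`
   (`blockSpin_blockSpin`, for `b' ≥ 1`) and its push-forward form `blockSpinLaw_blockSpinLaw`.
   Discrete scales `b ∈ ℕ` (multiplicative semigroup); the continuous-scale semiflow the route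
   ultimately wants is level 1.

## References
* R. Bauerschmidt, T. Bodineau, B. Dagallier, *Stochastic dynamics and the Polchinski equation:
  an introduction*, Probab. Surveys 21 (2024), arXiv:2307.07619, §3.1 (Gaussian integration,
  covariance decompositions), §3.2 Def. 2 (renormalised potential, Polchinski semigroup,
  renormalised measure), (3.12) (fluctuation measure), Prop. 6–8. Read: TeX chunks 12–14.
  [BauerschmidtBodineauDagallierPolchinski2024]
* R. Bauerschmidt, B. Dagallier, *Log-Sobolev inequality for near critical Ising models*,
  Comm. Pure Appl. Math. 77 (2024), arXiv:2202.02301, §1.2 (the Ising renormalised measure). [BauerschmidtDagallier2023]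
* L. P. Kadanoff, Physics 2 (1966) 263 (block spins) — folklore form.
-/

noncomputable section

open MeasureTheory ProbabilityTheory
open scoped MatrixOrder

namespace Literature.Probability.LatticeModels

/-! ## 1. The Polchinski flow in finite dimension (BBD §3) -/

namespace Polchinski

variable {ι : Type*} [Fintype ι] [DecidableEq ι]

/-- A **covariance decomposition** `C_∞ = ∫_0^∞ Ċ_s ds` in the sense of BBD §3.1, recorded by
its primitives: positive semidefinite matrices `C_t` (`t ≥ 0`; values at `t < 0` are unused)
increasing in `t` as quadratic forms, `C_0 = 0`, all below the terminal covariance `C_∞`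
(differentiability in `t` is not required for the definitions below and is not recorded).
[cite: BauerschmidtBodineauDagallierPolchinski2024, §3.1 (covariance decomposition)] -/
structure CovDecomposition (ι : Type*) [Fintype ι] [DecidableEq ι] where
  /-- `C_t` -/
  cov : ℝ → Matrix ι ι ℝ
  /-- `C_∞` -/
  covInf : Matrix ι ι ℝ
  /-- `C_0 = 0` -/
  cov_zero : cov 0 = 0
  /-- each `C_t` is positive semidefinite -/
  posSemidef_cov : ∀ t, 0 ≤ t → (cov t).PosSemidef
  /-- `C_t` increases as a quadratic form -/
  posSemidef_sub : ∀ s t, 0 ≤ s → s ≤ t → (cov t - cov s).PosSemidef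
  /-- `C_t ≤ C_∞` -/
  posSemidef_covInf_sub : ∀ t, 0 ≤ t → (covInf - cov t).PosSemidef

/-- The Gaussian expectation `𝖤_C[G(ζ)]` with covariance matrix `C` (Mathlib's
`multivariateGaussian 0 C`; `= δ_0` when `C = 0`). [cite: BauerschmidtBodineauDagallierPolchinski2024, §3.1 eq. (3.1)] -/
def gaussExpect (C : Matrix ι ι ℝ) (G : EuclideanSpace ℝ ι → ℝ) : ℝ :=
  ∫ ζ, G ζ ∂(multivariateGaussian 0 C)

/-- **The renormalised potential** `V_t(φ) = -log 𝖤_{C_t}[e^{-V₀(φ + ζ)}]` (BBD Def. 2,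
eq. (3.8)). [cite: BauerschmidtBodineauDagallierPolchinski2024, §3.2 Def. 2 eq. (3.8)] -/
def renormPotential (D : CovDecomposition ι) (V₀ : EuclideanSpace ℝ ι → ℝ) (t : ℝ)
    (φ : EuclideanSpace ℝ ι) : ℝ :=
  -Real.log (gaussExpect (D.cov t) fun ζ => Real.exp (-V₀ (φ + ζ)))

/-- The terminal renormalised potential `V_∞(φ) = -log 𝖤_{C_∞}[e^{-V₀(φ+ζ)}]` (its value at `0`
is minus the log-partition function of `ν₀`). [cite: BauerschmidtBodineauDagallierPolchinski2024, §3.2 eq. (3.11)] -/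
def renormPotentialInf (D : CovDecomposition ι) (V₀ : EuclideanSpace ℝ ι → ℝ)
    (φ : EuclideanSpace ℝ ι) : ℝ :=
  -Real.log (gaussExpect D.covInf fun ζ => Real.exp (-V₀ (φ + ζ)))

/-- **The Polchinski semigroup** `𝖯_{s,t}F(φ) = e^{V_t(φ)} 𝖤_{C_t - C_s}[e^{-V_s(φ+ζ)} F(φ+ζ)]`
(`s ≤ t`; BBD Def. 2, eq. (3.9)). [cite: BauerschmidtBodineauDagallierPolchinski2024, §3.2 Def. 2 eq. (3.9)] -/
def semigroup (D : CovDecomposition ι) (V₀ : EuclideanSpace ℝ ι → ℝ) (s t : ℝ)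
    (F : EuclideanSpace ℝ ι → ℝ) (φ : EuclideanSpace ℝ ι) : ℝ :=
  Real.exp (renormPotential D V₀ t φ) *
    gaussExpect (D.cov t - D.cov s) fun ζ => Real.exp (-renormPotential D V₀ s (φ + ζ)) * F (φ + ζ)

/-- The un-normalised renormalised measure `e^{-V_t(ζ)} 𝖯_{C_∞ - C_t}(dζ)`.
[cite: BauerschmidtBodineauDagallierPolchinski2024, §3.2 Def. 2 eq. (3.10)] -/
def renormMeasureRaw (D : CovDecomposition ι) (V₀ : EuclideanSpace ℝ ι → ℝ) (t : ℝ) :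
    Measure (EuclideanSpace ℝ ι) :=
  (multivariateGaussian 0 (D.covInf - D.cov t)).withDensity fun ζ =>
    ENNReal.ofReal (Real.exp (-renormPotential D V₀ t ζ))

/-- **The renormalised measure** `ν_t`: `𝔼_{ν_t}[F] ∝ 𝖤_{C_∞ - C_t}[e^{-V_t(ζ)} F(ζ)]`,
normalised to total mass one (BBD Def. 2, eq. (3.10), where the normalisation is written
`e^{V_∞(0)}`). At `t = 0` this is `ν₀ ∝ e^{-V₀} d𝖯_{C_∞}` (eq. (3.7)).
[cite: BauerschmidtBodineauDagallierPolchinski2024, §3.2 Def. 2 eq. (3.10)] -/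
def renormMeasure (D : CovDecomposition ι) (V₀ : EuclideanSpace ℝ ι → ℝ) (t : ℝ) :
    Measure (EuclideanSpace ℝ ι) :=
  (renormMeasureRaw D V₀ t Set.univ)⁻¹ • renormMeasureRaw D V₀ t

/-- **The fluctuation measure** `μ_t^φ`: `𝔼_{μ_t^φ}[F(ζ)] = 𝖤_{C_t}[e^{-V₀(φ+ζ)}F(φ+ζ)] /
𝖤_{C_t}[e^{-V₀(φ+ζ)}] = 𝖯_{0,t}F(φ)` (BBD eq. (3.12)), as a measure on the variable `φ + ζ`.
[cite: BauerschmidtBodineauDagallierPolchinski2024, §3.2 eq. (3.12)] -/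
def fluctuationMeasure (D : CovDecomposition ι) (V₀ : EuclideanSpace ℝ ι → ℝ) (t : ℝ)
    (φ : EuclideanSpace ℝ ι) : Measure (EuclideanSpace ℝ ι) :=
  let raw := ((multivariateGaussian 0 (D.cov t)).map fun ζ => φ + ζ).withDensity fun ψ =>
    ENNReal.ofReal (Real.exp (-V₀ ψ))
  (raw Set.univ)⁻¹ • raw

/-- The Gaussian measure with zero covariance is the point mass at the mean. [folklore] -/
theorem multivariateGaussian_zero_zero :
    multivariateGaussian (0 : EuclideanSpace ℝ ι) (0 : Matrix ι ι ℝ) = Measure.dirac 0 := by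
  rw [multivariateGaussian, show CFC.sqrt (0 : Matrix ι ι ℝ) = 0 from CFC.sqrt_zero]
  simp only [map_zero, zero_apply, add_zero]
  rw [Measure.map_const, measure_univ, one_smul]

/-- `𝖤_0[G] = G(0)`. [folklore] -/
theorem gaussExpect_zero (G : EuclideanSpace ℝ ι → ℝ) : gaussExpect (0 : Matrix ι ι ℝ) G = G 0 := by
  rw [gaussExpect, multivariateGaussian_zero_zero, integral_dirac]

/-- **`V` at time `0` is `V₀`** (`C_0 = 0`, `𝖯_0 = δ_0`). [cite: BauerschmidtBodineauDagallierPolchinski2024, §3.2 Def. 2] -/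
theorem renormPotential_zero (D : CovDecomposition ι) (V₀ : EuclideanSpace ℝ ι → ℝ)
    (φ : EuclideanSpace ℝ ι) : renormPotential D V₀ 0 φ = V₀ φ := by
  rw [renormPotential, D.cov_zero, gaussExpect_zero, add_zero, Real.log_exp, neg_neg]

/-- **`𝖯_{t,t} = id`** (Gaussian expectation with zero covariance). [cite: BauerschmidtBodineauDagallierPolchinski2024, §3.2 Prop. 7 (semigroup property)] -/
theorem semigroup_self (D : CovDecomposition ι) (V₀ : EuclideanSpace ℝ ι → ℝ) (t : ℝ)
    (F : EuclideanSpace ℝ ι → ℝ) (φ : EuclideanSpace ℝ ι) :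
    semigroup D V₀ t t F φ = F φ := by
  rw [semigroup, sub_self, gaussExpect_zero, add_zero, ← mul_assoc, ← Real.exp_add,
    add_neg_cancel, Real.exp_zero, one_mul]

end Polchinski

/-! ## 2. Kadanoff block spins on `ℤ^d` (the lattice variant) -/

namespace Kadanoff

variable {d : ℕ}

/-- The cells of a block: `[0, b)^d ⊆ ℕ^d`. [folklore] -/
def blockCells (d b : ℕ) : Finset (Fin d → ℕ) := Fintype.piFinset fun _ => Finset.range b

/-- **The block-spin map**: `(blockSpin b c φ)(x) = c · ∑_{y ∈ [0,b)^d} φ(b·x + y)` — for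
`c = b^{-d}` the Kadanoff block AVERAGE over the cube `b x + [0,b)^d` (rescaled to unit lattice
spacing), for general `c` a block spin with field renormalisation `c`.
[folklore] -/
def blockSpin (b : ℕ) (c : ℝ) (φ : Site d → ℝ) : Site d → ℝ :=
  fun x => c * ∑ y ∈ blockCells d b, φ (fun i => (b : ℤ) * x i + (y i : ℤ))

/-- The block-spin map is measurable (a finite sum of coordinate evaluations). [folklore] -/
theorem measurable_blockSpin (b : ℕ) (c : ℝ) : Measurable (blockSpin (d := d) b c) := by
  refine measurable_pi_lambda _ fun x => ?_
  refine Measurable.const_mul ?_ c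
  refine Finset.measurable_sum _ fun y _ => ?_
  exact measurable_pi_apply _

/-- **Semigroup property of block spins**: blocking by `b'` and then by `b` is blocking by
`b * b'` with the product of the field renormalisations —
`blockSpin b c (blockSpin b' c' φ) = blockSpin (b * b') (c * c') φ` (the cells
`(y, z) ∈ [0,b)^d × [0,b')^d` reparametrise `[0, b b')^d` by `w = b' y + z`). [folklore] -/
theorem blockSpin_blockSpin {b b' : ℕ} (hb' : 0 < b') (c c' : ℝ) (φ : Site d → ℝ) :
    blockSpin b c (blockSpin b' c' φ) = blockSpin (b * b') (c * c') φ := by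
  funext x
  unfold blockSpin
  rw [← Finset.mul_sum, ← mul_assoc]
  congr 1
  rw [← Finset.sum_product']
  refine Finset.sum_nbij' (fun p => fun k => b' * p.1 k + p.2 k)
    (fun w => (fun k => w k / b', fun k => w k % b')) ?_ ?_ ?_ ?_ ?_
  · rintro ⟨y, z⟩ hp
    rw [Finset.mem_product] at hp
    obtain ⟨hy, hz⟩ := hp
    simp only [blockCells, Fintype.mem_piFinset, Finset.mem_range] at hy hz ⊢
    intro k
    have h1 : b' * y k + b' ≤ b * b' := by
      have := Nat.mul_le_mul_left b' (Nat.succ_le_of_lt (hy k))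
      rw [Nat.mul_succ, mul_comm b b'] at *
      exact this
    have h2 := hz k
    omega
  · intro w hw
    simp only [blockCells, Fintype.mem_piFinset, Finset.mem_range, Finset.mem_product] at hw ⊢
    exact ⟨fun k => (Nat.div_lt_iff_lt_mul hb').2 (hw k),
      fun k => Nat.mod_lt _ hb'⟩
  · rintro ⟨y, z⟩ hp
    rw [Finset.mem_product] at hp
    obtain ⟨-, hz⟩ := hp
    simp only [blockCells, Fintype.mem_piFinset, Finset.mem_range] at hz
    refine Prod.ext (funext fun k => ?_) (funext fun k => ?_)
    · show (b' * y k + z k) / b' = y k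
      rw [Nat.add_comm, Nat.add_mul_div_left _ _ hb', Nat.div_eq_of_lt (hz k), Nat.zero_add]
    · show (b' * y k + z k) % b' = z k
      rw [Nat.add_comm, Nat.add_mul_mod_self_left, Nat.mod_eq_of_lt (hz k)]
  · intro w _
    funext k
    show b' * (w k / b') + w k % b' = w k
    exact Nat.div_add_mod (w k) b'
  · rintro ⟨y, z⟩ _
    congr 1
    funext i
    push_cast
    ring

/-- The embedding of `±1` spin configurations into real fields (`σ ↦ (x ↦ σ_x ∈ ℝ)`).
[folklore] -/
def spinField (σ : SpinConfig (Site d)) : Site d → ℝ := fun x => spinAt x σ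

/-- `spinField` is measurable. [folklore] -/
theorem measurable_spinField : Measurable (spinField (d := d)) :=
  measurable_pi_lambda _ fun x => measurable_spinAt x

/-- **The Kadanoff map on laws**: the law of the block spins `blockSpin b c φ` when the field
`φ` has law `μ` (push-forward). For the Ising model feed `μ = (plus / torus Gibbs measure).map
spinField`. [folklore] -/
def blockSpinLaw (b : ℕ) (c : ℝ) (μ : Measure (Site d → ℝ)) : Measure (Site d → ℝ) :=
  μ.map (blockSpin b c)

/-- **Semigroup property on laws**: `blockSpinLaw b c (blockSpinLaw b' c' μ) =
blockSpinLaw (b * b') (c * c') μ` for `b' ≥ 1`. [folklore] -/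
theorem blockSpinLaw_blockSpinLaw {b b' : ℕ} (hb' : 0 < b') (c c' : ℝ)
    (μ : Measure (Site d → ℝ)) :
    blockSpinLaw b c (blockSpinLaw b' c' μ) = blockSpinLaw (b * b') (c * c') μ := by
  rw [blockSpinLaw, blockSpinLaw, blockSpinLaw,
    Measure.map_map (measurable_blockSpin b c) (measurable_blockSpin b' c')]
  congr 1
  funext φ
  exact blockSpin_blockSpin hb' c c' φ

/-- Block-spin laws of probability measures are probability measures. [folklore] -/
instance (b : ℕ) (c : ℝ) (μ : Measure (Site d → ℝ)) [IsProbabilityMeasure μ] :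
    IsProbabilityMeasure (blockSpinLaw b c μ) :=
  Measure.isProbabilityMeasure_map (measurable_blockSpin b c).aemeasurable

end Kadanoff

end Literature.Probability.LatticeModels
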